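import Summits.BirchSwinnertonDyer.BirchSwinnertonDyer.Theorems.ResidualThetaTransportAtTwoThetaTransportResidualCarriers
import HarnessLib

/-!
# Stub `stub_residualIso` of line «bt26-lambda» on crux (R≥)ᵖ `ResidualThetaCountLowerPureAtTwo` — PROVED:
# the residual isomorphism `((W[2^∞])[2])^{⊕f} ≅ A_g[ϖ]` of `Γ_ℚ`-modules from the congruence `g ≡ W`

Route `ResidualThetaTransportAtTwo` (RTT), crux (R≥)ᵖ `ResidualThetaCountLowerPureAtTwo` (stmt-BirchSwinnertonDyer-26074),
line «bt26-lambda» (`Cruxes/ResidualThetaCountLowerPureAtTwo/Lines/bt26_lambda.lean`, reshaped by lead rtt-p2 g12: the residual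
isomorphism (b) of `stub_transport` is split off as the registered stub `stub_residualIso` and fed to `stub_transport` as a
hypothesis); seat `prover-bsd-wall-rtt-p2` g12 (`--supports`, closes nothing by itself). HONEST FRAMING: THEOREMS ONLY (no definition,
no named fact, no instance, no `sorry`); BSD is not proved by any of this; the crux stays open (stubs `stub_thetaDatum`,
`stub_transport`, `stub_cmLambdaLower`).

WHAT. `Summit.…Cruxes.ResidualThetaCountLowerPureAtTwo.Bt26Lambda.stub_residualIso` — the registered stub BY NAME and signature:
on the habitat (`GoodSS W 2`, `Δ_W < 0`), for a newform `g ∈ S₂(Γ₀(M))` with `ι : K_g → ℚ̄₂` congruent to `W` off `2·M·N_W`, every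
framed `ρ : Γ_ℚ → GL₂(𝒪)` (`𝒪 = padicCoeffIntegers (range ι)`) unramified with Frobenius polynomial `X² − ι(a_ℓ)X + ℓ` at every
`ℓ ∤ 2M`, and every irreducible `ϖ ∈ 𝒪`: `∃ f > 0` with `#(𝒪/ϖ) = 2^f` and an injective, `Γ_ℚ`-equivariant additive map
`j : ((W[2^∞])[2])^f → A_g = Cofree ρ E` with image `A_g[ϖ] = {a | ϖ • a = 0}`. Assembly of the companions
(`ThetaTransport.exists_conj_rhoMat_map_eq` — Chebotarev + Brauer–Nesbitt; `exists_cofree_torsionCarrier`; `exists_torsionPow_carrier`;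
`exists_ringHom_basis_residueField`) along `GreenbergVatsal2000.torsionToPrimary : W[2] ≅ (W[2^∞])[2]`; also recorded in the
`ThetaTransport` namespace as `residualIso`.

References: [DarmonDiamondTaylor1995] Prop. 2.6 (b); [DeligneSerreASENS1974] 6.7; [SerreInventiones1972] §5.3;
[EmertonPollackWeston2006] §3.1.
-/

set_option autoImplicit false
-- the Theorems namespace of this sub repeats the summit name by design (D-0017 nested layout)
set_option linter.dupNamespace false

noncomputable section

open scoped MatrixGroups
open Matrix WeierstrassCurve NumberField Field IsDedekindDomain
  Literature.NumberTheory.EllipticCurves Literature.NumberTheory.EllipticCurves.DokchitserDokchitser2012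
  Literature.NumberTheory.GaloisRepresentations Literature.NumberTheory.EllipticCurves.Rank1Residual
  Literature.NumberTheory.EllipticCurves.GreenbergSelmer Rat.HeightOneSpectrum

namespace Summit.BirchSwinnertonDyer.BirchSwinnertonDyer.Theorems.ThetaTransport

-- (the assembly elaborates several postponed instance problems on `k² = (𝒪/ϖ)²`; measured ≈ 3× the default budget)
set_option maxHeartbeats 1600000 in
/-- **The residual isomorphism of the θ-transport line** (`stub_transport` (b)): `((W[2^∞])[2])^{⊕f} ↪ A_g` onto `A_g[ϖ]`,
`Γ_ℚ`-equivariantly, `2^f = #(𝒪/ϖ)`. [cite: DarmonDiamondTaylor1995, Prop. 2.6 (b) (PDF p. 53)] [cite: DeligneSerreASENS1974, 6.7] -/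
theorem residualIso (W : WeierstrassCurve ℚ) [W.IsElliptic] [W.IsGloballyMinimal] (hss : GoodSS W 2) (hΔ : W.Δ < 0)
    {M : ℕ} [NeZero M] (g : CuspForm (CongruenceSubgroup.Gamma0 M) 2)
    (ι : ModularForms.coeffField g →+* PadicAlgCl 2) (hnew : ModularForms.IsNewform0 g)
    (hcong : ∀ ℓ : ℕ, ℓ.Prime → ¬ ℓ ∣ 2 * M * W.conductorNorm ℤ →
      ‖embCoeff g ι ℓ - (W.frobeniusTrace ℓ : PadicAlgCl 2)‖ < 1)
    (ρ : FramedGaloisRep ℚ ↥(padicCoeffIntegers (Set.range ι)) 2)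
    (hρ : ∀ v : HeightOneSpectrum (𝓞 ℚ), ¬ natGenerator v ∣ 2 * M →
      FramedGaloisRep.IsUnramifiedAt v ρ ∧ ∃ P : Polynomial ↥(padicCoeffIntegers (Set.range ι)),
        P.map (padicCoeffIntegers (Set.range ι)).subtype =
          Polynomial.X ^ 2 - Polynomial.C (embCoeff g ι (natGenerator v)) * Polynomial.X +
            Polynomial.C ((natGenerator v : ℕ) : PadicAlgCl 2) ∧
        FramedGaloisRep.HasFrobCharpolyAt v P ρ)
    (ϖ : ↥(padicCoeffIntegers (Set.range ι))) (hϖ : Irreducible ϖ) :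
    ∃ f : ℕ, 0 < f ∧ Nat.card (↥(padicCoeffIntegers (Set.range ι)) ⧸ Ideal.span {ϖ}) = 2 ^ f ∧
      ∃ j : (Fin f → ↥(AddSubgroup.torsionBy ↥(W.geomPrimaryTorsion 2) (2 : ℤ))) →+
          Cofree ρ ↥(padicCoeffField (Set.range ι)),
        Function.Injective j ∧
        (∀ (σ : absoluteGaloisGroup ℚ) (x : Fin f → ↥(AddSubgroup.torsionBy ↥(W.geomPrimaryTorsion 2) (2 : ℤ))),
            j (σ • x) = σ • j x) ∧
        Set.range j = {a | ϖ • a = 0} := by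
  classical
  haveI : FiniteDimensional ℚ (ModularForms.coeffField g) :=
    ModularForms.IsNewform0.finiteDimensional_coeffField_holds hnew
  haveI : FiniteDimensional ℚ_[2] ↥(padicCoeffField (Set.range ι)) :=
    GreenbergSelmer.finiteDimensional_padicCoeffField ι
  obtain ⟨f, d, b, hd, hcard, hb⟩ := exists_ringHom_basis_residueField (Set.range ι) ϖ hϖ
  refine ⟨d, hd, hcard, ?_⟩
  -- a frame of `W[2]` (in the `(2 : ℤ)`-torsion spelling), the conjugacy, and the two carriers
  obtain ⟨e⟩ : Nonempty (geomTorsion W 2 ≃+ (Fin 2 → ZMod 2)) :=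
    nonempty_geomTorsion_addEquiv_fin_two W (m := 2) (by norm_num)
  obtain ⟨P, hP⟩ := exists_conj_rhoMat_map_eq W hss hΔ g ι hnew hcong ρ hρ ϖ hϖ e f
  obtain ⟨jg, hjg_inj, hjg_smul, hjg_range⟩ := exists_cofree_torsionCarrier ρ ϖ hϖ.ne_zero
  obtain ⟨jW, hjW⟩ := exists_torsionPow_carrier W e f b hb
  -- `(W[2^∞])[2] ≅ W[2]`, equivariantly (`GreenbergVatsal2000.torsionToPrimary`)
  obtain ⟨t, ht, ht_smul⟩ : ∃ t : geomTorsion W 2 →+ ↥(AddSubgroup.torsionBy ↥(W.geomPrimaryTorsion 2) (2 : ℤ)),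
      Function.Bijective t ∧ ∀ (σ : absoluteGaloisGroup ℚ) (Q : geomTorsion W 2), t (σ • Q) = σ • t Q :=
    ⟨GreenbergVatsal2000.torsionToPrimary W 2,
      ⟨ResidualLayer.torsionToPrimary_injective W, ResidualLayer.torsionToPrimary_surjective W⟩,
      ResidualLayer.torsionToPrimary_smul W⟩
  obtain ⟨e₀, he₀⟩ : ∃ e₀ : ↥(AddSubgroup.torsionBy ↥(W.geomPrimaryTorsion 2) (2 : ℤ)) ≃+ geomTorsion W 2,
      ∀ (σ : absoluteGaloisGroup ℚ) (y : ↥(AddSubgroup.torsionBy ↥(W.geomPrimaryTorsion 2) (2 : ℤ))),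
        e₀ (σ • y) = σ • e₀ y := by
    refine ⟨(AddEquiv.ofBijective t ht).symm, fun σ y ↦ ht.1 ?_⟩
    rw [ht_smul]
    change (AddEquiv.ofBijective t ht) ((AddEquiv.ofBijective t ht).symm (σ • y)) =
      σ • (AddEquiv.ofBijective t ht) ((AddEquiv.ofBijective t ht).symm y)
    rw [AddEquiv.apply_symm_apply, AddEquiv.apply_symm_apply]
  -- conjugation by `P⁻¹` on `k²`
  obtain ⟨Q, hQ⟩ : ∃ Q : (Fin 2 → ↥(padicCoeffIntegers (Set.range ι)) ⧸ Ideal.span {ϖ}) ≃+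
      (Fin 2 → ↥(padicCoeffIntegers (Set.range ι)) ⧸ Ideal.span {ϖ}),
      ∀ v, Q v = ((P⁻¹ : GL (Fin 2) _) : Matrix (Fin 2) (Fin 2) _) *ᵥ v :=
    ⟨{ toFun := fun v ↦ ((P⁻¹ : GL (Fin 2) _) : Matrix (Fin 2) (Fin 2) _) *ᵥ v
       invFun := fun v ↦ (P : Matrix (Fin 2) (Fin 2) _) *ᵥ v
       left_inv := fun v ↦ by simp only [Matrix.mulVec_mulVec, Units.mul_inv, Matrix.one_mulVec]
       right_inv := fun v ↦ by simp only [Matrix.mulVec_mulVec, Units.inv_mul, Matrix.one_mulVec]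
       map_add' := fun v w ↦ Matrix.mulVec_add _ v w }, fun _ ↦ rfl⟩
  -- the composite `x ↦ P⁻¹ · jW (e₀ ∘ x)`
  have hc_inj : Function.Injective fun x : Fin d → ↥(AddSubgroup.torsionBy ↥(W.geomPrimaryTorsion 2) (2 : ℤ)) ↦
      fun i ↦ e₀ (x i) := fun x y h ↦ funext fun i ↦ e₀.injective (congr_fun h i)
  have hc_surj : Function.Surjective fun x : Fin d → ↥(AddSubgroup.torsionBy ↥(W.geomPrimaryTorsion 2) (2 : ℤ)) ↦
      fun i ↦ e₀ (x i) := fun z ↦ ⟨fun i ↦ e₀.symm (z i), funext fun i ↦ e₀.apply_symm_apply (z i)⟩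
  obtain ⟨pre, hpre_bij, hpre⟩ :
      ∃ pre : (Fin d → ↥(AddSubgroup.torsionBy ↥(W.geomPrimaryTorsion 2) (2 : ℤ))) →+
        (Fin 2 → ↥(padicCoeffIntegers (Set.range ι)) ⧸ Ideal.span {ϖ}),
        Function.Bijective pre ∧ ∀ x, pre x = ((P⁻¹ : GL (Fin 2) _) : Matrix (Fin 2) (Fin 2) _) *ᵥ jW (fun i ↦ e₀ (x i)) := by
    refine ⟨Q.toAddMonoidHom.comp (jW.toAddMonoidHom.comp
      (AddMonoidHom.mk' (fun x i ↦ e₀ (x i)) fun x y ↦ funext fun i ↦ map_add e₀ (x i) (y i))), ?_, fun x ↦ ?_⟩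
    · exact Q.bijective.comp (jW.bijective.comp ⟨hc_inj, hc_surj⟩)
    · rw [← hQ]; rfl
  refine ⟨jg.comp pre, hjg_inj.comp hpre_bij.1, fun σ x ↦ ?_, ?_⟩
  · -- equivariance
    have hx : (fun i ↦ e₀ ((σ • x) i)) = fun i ↦ σ • e₀ (x i) := funext fun i ↦ by rw [Pi.smul_apply, he₀]
    have hmat : ((P⁻¹ : GL (Fin 2) _) : Matrix (Fin 2) (Fin 2) _) *ᵥ jW (fun i ↦ e₀ ((σ • x) i)) =
        (((ρ σ : GL (Fin 2) ↥(padicCoeffIntegers (Set.range ι))) :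
            Matrix (Fin 2) (Fin 2) ↥(padicCoeffIntegers (Set.range ι))).map (Ideal.Quotient.mk (Ideal.span {ϖ}))) *ᵥ
          (((P⁻¹ : GL (Fin 2) _) : Matrix (Fin 2) (Fin 2) _) *ᵥ jW (fun i ↦ e₀ (x i))) := by
      rw [hx, hjW, hP σ, Matrix.mulVec_mulVec, Matrix.mulVec_mulVec, ← Matrix.mul_assoc, ← Matrix.mul_assoc,
        Units.inv_mul, Matrix.one_mul]
    rw [AddMonoidHom.comp_apply, AddMonoidHom.comp_apply, hpre, hpre, hmat, hjg_smul]
  · -- range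
    rw [AddMonoidHom.coe_comp, hpre_bij.2.range_comp]
    exact hjg_range

end Summit.BirchSwinnertonDyer.BirchSwinnertonDyer.Theorems.ThetaTransport

namespace Summit.BirchSwinnertonDyer.BirchSwinnertonDyer.Cruxes.ResidualThetaCountLowerPureAtTwo.Bt26Lambda

/-- **Registered stub `stub_residualIso` of line «bt26-lambda» (crux (R≥)ᵖ, stmt-BirchSwinnertonDyer-26074), by name and signature**:
the residual isomorphism `((W[2^∞])[2])^{⊕f} ≅ A_g[ϖ]` (`2^f = #(𝒪/ϖ)`) for the congruent newform datum on the habitat —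
`ThetaTransport.residualIso`. [cite: DarmonDiamondTaylor1995, Prop. 2.6 (b) (PDF p. 53)] [cite: DeligneSerreASENS1974, 6.7] -/
theorem stub_residualIso : ∀ (W : WeierstrassCurve ℚ) [W.IsElliptic] [W.IsGloballyMinimal],
    Literature.NumberTheory.EllipticCurves.Rank1Residual.GoodSS W 2 → W.Δ < 0 →
    ∀ (M : ℕ) [NeZero M] (g : CuspForm (CongruenceSubgroup.Gamma0 M) 2)
      (ι : Literature.NumberTheory.EllipticCurves.ModularForms.coeffField g →+* PadicAlgCl 2),
      Literature.NumberTheory.EllipticCurves.ModularForms.IsNewform0 g →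
      (∀ ℓ : ℕ, ℓ.Prime → ¬ ℓ ∣ 2 * M * W.conductorNorm ℤ →
        ‖Literature.NumberTheory.EllipticCurves.embCoeff g ι ℓ - (W.frobeniusTrace ℓ : PadicAlgCl 2)‖ < 1) →
      ∀ (ρ : Literature.NumberTheory.GaloisRepresentations.FramedGaloisRep ℚ
          ↥(Literature.NumberTheory.EllipticCurves.padicCoeffIntegers (Set.range ι)) 2),
        (∀ v : IsDedekindDomain.HeightOneSpectrum (NumberField.RingOfIntegers ℚ),
          ¬ Rat.HeightOneSpectrum.natGenerator v ∣ 2 * M →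
            Literature.NumberTheory.GaloisRepresentations.FramedGaloisRep.IsUnramifiedAt v ρ ∧
            ∃ P : Polynomial ↥(Literature.NumberTheory.EllipticCurves.padicCoeffIntegers (Set.range ι)),
              Polynomial.map (Literature.NumberTheory.EllipticCurves.padicCoeffIntegers (Set.range ι)).subtype P =
                Polynomial.X ^ 2 - Polynomial.C (Literature.NumberTheory.EllipticCurves.embCoeff g ι
                  (Rat.HeightOneSpectrum.natGenerator v)) * Polynomial.X +
                  Polynomial.C ((Rat.HeightOneSpectrum.natGenerator v : ℕ) : PadicAlgCl 2) ∧
              Literature.NumberTheory.GaloisRepresentations.FramedGaloisRep.HasFrobCharpolyAt v P ρ) →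
        ∀ (ϖ : ↥(Literature.NumberTheory.EllipticCurves.padicCoeffIntegers (Set.range ι))), Irreducible ϖ →
          ∃ f : ℕ, 0 < f ∧
            Nat.card (↥(Literature.NumberTheory.EllipticCurves.padicCoeffIntegers (Set.range ι)) ⧸ Ideal.span {ϖ}) = 2 ^ f ∧
            ∃ j : (Fin f → ↥(AddSubgroup.torsionBy ↥(W.geomPrimaryTorsion 2) (2 : ℤ))) →+
                Literature.NumberTheory.EllipticCurves.GreenbergSelmer.Cofree ρ
                  ↥(Literature.NumberTheory.EllipticCurves.padicCoeffField (Set.range ι)),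
              Function.Injective j ∧
              (∀ (σ : Field.absoluteGaloisGroup ℚ)
                  (x : Fin f → ↥(AddSubgroup.torsionBy ↥(W.geomPrimaryTorsion 2) (2 : ℤ))), j (σ • x) = σ • j x) ∧
              Set.range j = {a | ϖ • a = 0} :=
  fun W _ _ hss hΔ _ _ g ι hnew hcong ρ hρ ϖ hϖ ↦
    Summit.BirchSwinnertonDyer.BirchSwinnertonDyer.Theorems.ThetaTransport.residualIso W hss hΔ g ι hnew hcong ρ hρ ϖ hϖ

end Summit.BirchSwinnertonDyer.BirchSwinnertonDyer.Cruxes.ResidualThetaCountLowerPureAtTwo.Bt26Lambda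

end
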